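import Summits.Ventures.DiscreteObjects.Hadamard.ConferenceGraph333OrbitRowIdentity
import Summits.Ventures.DiscreteObjects.Hadamard.ConferenceGraph333Order5Normalizing41
import Summits.Ventures.DiscreteObjects.Hadamard.ConferenceGraph333FixedConference

/-!
# No element of order `5` normalises an element of order `41` in Aut(srg(333,166,82,83)): `N(⟨ρ₄₁⟩)` is a `{2,41}`-group (kernel)

Framing: lottery ticket; floor = certified bounds/negative ranges.  Cell pub-namedobj (venture DiscreteObjects),
target (H) = `H(668)`, hadamard gen 33.  HANDOFF-H-g32 item 6 SETTLED IN THE NEGATIVE: the Frobenius configuration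
`ℤ/41 ⋊ ℤ/5` of `ConferenceGraph333Order5Normalizing41` (an automorphism `τ` of order `5` with `τ ρ = ρ^m τ` for `ρ` of
order `41`: `13` fixed vertices, namely `Fix ρ` and one vertex `b_j` in each of the eight `ρ`-orbits `O_j`) does NOT occur.
* **`no_order5_normalizing_order41`** — for `ρ^41 = 1 ≠ ρ`, `τ^5 = 1 ≠ τ`, `τ ρ = ρ^m τ`, both automorphisms: `False`.
  Proof: take a `τ`-fixed `ρ`-moved vertex `b`.  The orbit row identity (`ConferenceGraph333OrbitRowIdentity`) at `b` reads
  `(40 − 2v)² + Σ_{j} (41 − 2x_j)² = 87` over the seven other orbits (`v = |N(b) ∩ orb b|`, `x_j = |N(b) ∩ O_j|`); the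
  `τ`-invariance of `N(b) ∩ O_j` gives `x_j ≡ A_{b b_j} (mod 5)` and `v ≡ 0 (mod 5)` (`|S| ≡ |S ∩ Fix τ|`), `v` is even, so
  `v = 20`; `Fix τ = srg(13,6,2,3)` (gen 30) gives `c + Σ_j A_{b b_j} = 6` with `c = |N(b) ∩ Fix ρ|`, and the valency of `b` gives
  `Σ_j x_j = 146 − c`; these are the hypotheses of `frob41_endgame`.
* **`normalizer41_prime_dvd_card_g33`**, **`normalizer41_card_shape`** — a group of automorphisms normalising `⟨ρ₄₁⟩`
  (`ρ₄₁ ∈ N`) is a `{2,41}`-group, `|N| = 41 · 2^a` (gen 32 `Normalizers41And37` had `{2,5,41}`; `41² ∤ |Aut|`, gen 29).  So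
  `5 ∤ |N_Aut(P₄₁)|`: with `|C(ρ₄₁)| ∈ {41, 82}` (gen 32) and `N/C ↪ Aut(ℤ/41)` the Sylow `41`-normaliser has order
  `41 · 2^a`, `a ≤ 4`.
E2 (exact, pure python): pub-namedobj-hadamard-g33/code/check_frobenius41x5_endgame.py (laws L1–L5 ⇒ 0 solutions; without
`τ`: 138 admissible orbit-matrix rows).
WORDS: structure of a HYPOTHETICAL object; no srg(333,166,82,83) / C(334) / H(668) is constructed or excluded; no element ORDER
is newly excluded (order `205` was already out); what is excluded is the SUBGROUP TYPE `ℤ/41 ⋊ ℤ/5` of Aut.  Method in print: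
orbit matrices (Behbahani–Lam, Discrete Math. 311 (2011) 132–144); instance and proofs ours (PROVISIONAL).
No `sorry`, no new definitions.
-/

namespace Summit.Ventures.DiscreteObjects.Hadamard

open Finset

section noFrobenius41
variable {V : Type*} [Fintype V] [DecidableEq V]

/-- **No element of order `5` of Aut(srg(333,166,82,83)) normalises an element of order `41`** (no subgroup `ℤ/41 ⋊ ℤ/5`). -/
theorem no_order5_normalizing_order41 (hV : Fintype.card V = 333) (A : Matrix V V ℤ)
    (h01 : ∀ x y, A x y = 0 ∨ A x y = 1) (hsymm : ∀ x y, A y x = A x y) (hdiag : ∀ x, A x x = 0)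
    (hk : ∀ x, ∑ y, A x y = 166) (hsrg : ∀ x y, ∑ z, A x z * A z y = 83 * (1 + (if x = y then 1 else 0)) - A x y)
    (ρ τ : Equiv.Perm V) (hρ : ρ ^ 41 = 1) (hρ1 : ρ ≠ 1) (hτ : τ ^ 5 = 1) (hτ1 : τ ≠ 1) {m : ℕ}
    (hnorm : τ * ρ = ρ ^ m * τ) (hAρ : ∀ x y, A (ρ x) (ρ y) = A x y) (hAτ : ∀ x y, A (τ x) (τ y) = A x y) :
    False := by
  classical
  have hp41 : Nat.Prime 41 := by norm_num
  have hp5 : Nat.Prime 5 := by norm_num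
  obtain ⟨hf13, hf5, huniq⟩ :=
    order5_normalizing_order41_structure hV A h01 hsymm hdiag hk hsrg ρ τ hρ hρ1 hτ hτ1 hnorm hAρ hAτ
  -- #Fix ρ = 5, hence Fix ρ ⊆ Fix τ
  obtain ⟨-, -, -, -, -, -, -, -, w41, -⟩ :=
    aut_prime_windows hV A h01 hsymm hdiag hk hsrg hp41 (by norm_num) ρ hρ hρ1 hAρ
  have hF5 : (univ.filter fun x => ρ x = x).card = 5 := w41 rfl
  have hFρτ : ∀ y, ρ y = y → τ y = y := by
    have hsub : (univ.filter fun x => ρ x = x ∧ τ x = x) ⊆ univ.filter fun x => ρ x = x := fun x hx => by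
      rw [Finset.mem_filter] at hx ⊢; exact ⟨hx.1, hx.2.1⟩
    have heq := Finset.eq_of_subset_of_card_le hsub (by rw [hF5, hf5])
    intro y hy
    have hy' : y ∈ univ.filter fun x => ρ x = x := Finset.mem_filter.mpr ⟨Finset.mem_univ _, hy⟩
    rw [← heq, Finset.mem_filter] at hy'
    exact hy'.2.2
  -- the eight `τ`-fixed `ρ`-moved vertices (one in each `ρ`-orbit)
  set B := univ.filter (fun x => τ x = x ∧ ¬ ρ x = x) with hB
  have hmemB : ∀ {x}, x ∈ B ↔ τ x = x ∧ ρ x ≠ x := fun {x} => by rw [hB, Finset.mem_filter]; simp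
  have hB8 : B.card = 8 := by
    have hsplit := Finset.card_filter_add_card_filter_not (s := univ.filter fun x => τ x = x) (fun x => ρ x = x)
    rw [Finset.filter_filter, Finset.filter_filter, hf13] at hsplit
    have e1 : (univ.filter fun x => τ x = x ∧ ρ x = x) = univ.filter fun x => ρ x = x ∧ τ x = x :=
      Finset.filter_congr fun x _ => ⟨fun h => ⟨h.2, h.1⟩, fun h => ⟨h.2, h.1⟩⟩
    rw [e1, hf5] at hsplit
    have e2 : (univ.filter fun x => τ x = x ∧ ¬ ρ x = x) = B := rfl
    rw [e2] at hsplit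
    omega
  -- `ρ`-orbits
  set orb : V → Finset V := fun x => (Finset.range 41).image (fun k => (ρ ^ k) x) with horb
  have horb_mem : ∀ x y, y ∈ orb x ↔ orb y = orb x := fun x y => mem_orbP_iff ρ (by norm_num) hρ x y
  have horb_card : ∀ x, ρ x ≠ x → (orb x).card = 41 := fun x hx => by
    simp only [horb]; rw [Finset.card_image_of_injOn (orbP_injOn ρ hp41 hρ x hx), Finset.card_range]
  have horb_self : ∀ x, x ∈ orb x := fun x =>
    Finset.mem_image.mpr ⟨0, Finset.mem_range.mpr (by norm_num), by simp⟩
  have honly : ∀ b' ∈ B, ∀ y ∈ orb b', τ y = y → y = b' := by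
    intro b' hb' y hy hτy
    obtain ⟨k, hk, rfl⟩ := Finset.mem_image.mp hy
    rw [Finset.mem_range] at hk
    by_cases hk0 : k = 0
    · subst hk0; simp
    · exact absurd hτy (huniq b' (hmemB.mp hb').1 (hmemB.mp hb').2 k (Nat.pos_of_ne_zero hk0) hk)
  have hdisj : (B : Set V).PairwiseDisjoint orb := by
    intro b₁ hb₁ b₂ hb₂ hne
    rw [Finset.mem_coe] at hb₁ hb₂
    rw [Function.onFun, Finset.disjoint_left]
    intro z hz1 hz2
    apply hne
    have e : orb b₁ = orb b₂ := ((horb_mem b₁ z).mp hz1).symm.trans ((horb_mem b₂ z).mp hz2)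
    exact honly b₂ hb₂ b₁ ((horb_mem b₂ b₁).mpr e) (hmemB.mp hb₁).1
  have horb_moved : ∀ b' ∈ B, ∀ y ∈ orb b', ρ y ≠ y := by
    intro b' hb' y hy h
    obtain ⟨k, -, rfl⟩ := Finset.mem_image.mp hy
    apply (hmemB.mp hb').2
    rw [← perm_pow_apply_comm] at h
    exact (ρ ^ k).injective h
  have hmoved : (univ.filter fun x => ¬ ρ x = x).card = 328 := by
    have h := Finset.card_filter_add_card_filter_not (s := (univ : Finset V)) (fun x => ρ x = x)
    rw [Finset.card_univ, hV, hF5] at h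
    omega
  have hcover : B.biUnion orb = univ.filter fun x => ¬ ρ x = x := by
    apply Finset.eq_of_subset_of_card_le
    · intro z hz
      obtain ⟨b', hb', hzb⟩ := Finset.mem_biUnion.mp hz
      exact Finset.mem_filter.mpr ⟨Finset.mem_univ _, horb_moved b' hb' z hzb⟩
    · rw [hmoved, Finset.card_biUnion hdisj, Finset.sum_congr rfl fun b' hb' => horb_card b' (hmemB.mp hb').2,
        Finset.sum_const, hB8]
      norm_num
  -- a sum over all vertices = the `ρ`-fixed part + the eight orbits, each summed along `k ↦ ρᵏ b'`
  have horbsum : ∀ b' ∈ B, ∀ f : V → ℤ, ∑ y ∈ orb b', f y = ∑ k ∈ Finset.range 41, f ((ρ ^ k) b') := by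
    intro b' hb' f
    simp only [horb]
    rw [Finset.sum_image (orbP_injOn ρ hp41 hρ b' (hmemB.mp hb').2)]
  have hsplit : ∀ f : V → ℤ, ∑ y, f y =
      ∑ y ∈ univ.filter (fun x => ρ x = x), f y + ∑ b' ∈ B, ∑ k ∈ Finset.range 41, f ((ρ ^ k) b') := by
    intro f
    rw [← Finset.sum_filter_add_sum_filter_not univ (fun x => ρ x = x) f, ← hcover, Finset.sum_biUnion hdisj,
      Finset.sum_congr rfl fun b' hb' => horbsum b' hb' f]
  -- `τ` maps each orbit of a vertex of `B` to itself
  have hτorb : ∀ b' ∈ B, ∀ y, y ∈ orb b' → τ y ∈ orb b' := by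
    intro b' hb' y hy
    obtain ⟨k, -, rfl⟩ := Finset.mem_image.mp hy
    have e := congrArg (fun g : Equiv.Perm V => g b') (normalizing_mul_pow τ ρ hnorm k)
    simp only [Equiv.Perm.mul_apply, (hmemB.mp hb').1] at e
    rw [e, perm_pow_apply_mod ρ hρ]
    exact Finset.mem_image.mpr ⟨(m * k) % 41, Finset.mem_range.mpr (Nat.mod_lt _ (by norm_num)), rfl⟩
  have hτorb_iff : ∀ b' ∈ B, ∀ y, τ y ∈ orb b' ↔ y ∈ orb b' := by
    intro b' hb' y
    refine ⟨fun h => ?_, hτorb b' hb' y⟩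
    have hj : ∀ (j : ℕ) z, z ∈ orb b' → (τ ^ j) z ∈ orb b' := by
      intro j; induction j with
      | zero => intro z hz; simpa using hz
      | succ j ih => intro z hz; rw [pow_succ', Equiv.Perm.mul_apply]; exact hτorb b' hb' _ (ih z hz)
    have h4 := hj 4 (τ y) h
    rwa [← Equiv.Perm.mul_apply, ← pow_succ, hτ, Equiv.Perm.one_apply] at h4
  -- the reference vertex b
  obtain ⟨b, hb⟩ : B.Nonempty := by rw [← Finset.card_pos, hB8]; norm_num
  have hτb : τ b = b := (hmemB.mp hb).1
  have hρb : ρ b ≠ b := (hmemB.mp hb).2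
  have hrow0 := seidel_orbit_row_identity hV A h01 hsymm hdiag hk hsrg hp41 ρ hρ hAρ hρb
  -- Seidel entries and the orbit sums of row b
  obtain ⟨-, hSo, -, -, -⟩ := seidel_identities_of_conferenceGraph A h01 hsymm hdiag 83
    (by rw [hV]; norm_num) (fun x => by rw [hk x]; norm_num) hsrg
  set S : V → V → ℤ := fun x y => 1 - (if x = y then 1 else 0) - 2 * A x y with hS_def
  have hSo' : ∀ x y, x ≠ y → S x y = 1 ∨ S x y = -1 := hSo
  set T : V → ℤ := fun y => ∑ k ∈ Finset.range 41, S b ((ρ ^ k) y) with hT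
  have hrow : ∑ y, S b y * T y = 292 := by
    have e : (333 : ℤ) - ((41 : ℕ) : ℤ) = 292 := by norm_num
    rw [e] at hrow0
    exact hrow0
  have hTρ : ∀ y, T (ρ y) = T y := by
    intro y
    simp only [hT]
    rw [Finset.sum_congr rfl fun k _ => show S b ((ρ ^ k) (ρ y)) = S b ((ρ ^ (k + 1)) y) by
      rw [pow_succ, Equiv.Perm.mul_apply]]
    exact sum_range_shift_periodic (fun k => S b ((ρ ^ k) y)) 41 (by simp [hρ])
  have hTk : ∀ (k : ℕ) y, T ((ρ ^ k) y) = T y := by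
    intro k; induction k with
    | zero => intro y; simp
    | succ k ih => intro y; rw [pow_succ', Equiv.Perm.mul_apply, hTρ, ih]
  have hTfix : ∀ y, ρ y = y → T y = 41 * S b y := by
    intro y hy
    simp only [hT]
    rw [Finset.sum_congr rfl fun k _ => by rw [Equiv.Perm.pow_apply_eq_self_of_apply_eq_self hy k],
      Finset.sum_const, Finset.card_range, nsmul_eq_mul]
    norm_num
  -- the main identity: Σ_{b' ∈ B} T(b')² = 87
  have hmain : ∑ b' ∈ B, T b' * T b' = 87 := by
    rw [hsplit (fun y => S b y * T y)] at hrow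
    have h1 : ∑ y ∈ univ.filter (fun x => ρ x = x), S b y * T y = 205 := by
      rw [Finset.sum_congr rfl fun y hy => show S b y * T y = 41 by
        have hy := (Finset.mem_filter.mp hy).2
        have hne : b ≠ y := fun h => hρb (by rw [h]; exact hy)
        rw [hTfix y hy]
        rcases hSo' b y hne with h | h <;> rw [h] <;> norm_num]
      rw [Finset.sum_const, hF5, nsmul_eq_mul]; norm_num
    have h2 : ∀ b', ∑ k ∈ Finset.range 41, S b ((ρ ^ k) b') * T ((ρ ^ k) b') = T b' * T b' := by
      intro b'
      rw [Finset.sum_congr rfl fun k _ => by rw [hTk k b'], ← Finset.sum_mul]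
    rw [h1, Finset.sum_congr rfl fun b' _ => h2 b'] at hrow
    linarith
  -- the orbit valencies x(b') = |N(b) ∩ orb b'| seen from b
  set x : V → ℤ := fun b' => ∑ k ∈ Finset.range 41, A b ((ρ ^ k) b') with hx
  have hx_orb : ∀ b', ρ b' ≠ b' → x b' = ∑ y ∈ orb b', A b y := by
    intro b' hb'
    simp only [hx, horb]
    rw [Finset.sum_image (orbP_injOn ρ hp41 hρ b' hb')]
  have hx_card : ∀ b', ρ b' ≠ b' → x b' = (((orb b').filter fun y => A b y = 1).card : ℤ) := by
    intro b' hb'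
    rw [hx_orb b' hb', ← Finset.sum_boole]
    refine Finset.sum_congr rfl fun y _ => ?_
    rcases h01 b y with h | h <;> simp [h]
  have hx_bounds : ∀ b', 0 ≤ x b' ∧ x b' ≤ 41 := by
    intro b'
    simp only [hx]
    constructor
    · exact Finset.sum_nonneg fun k _ => by rcases h01 b ((ρ ^ k) b') with h | h <;> simp [h]
    · calc ∑ k ∈ Finset.range 41, A b ((ρ ^ k) b') ≤ ∑ k ∈ Finset.range 41, (1 : ℤ) :=
            Finset.sum_le_sum fun k _ => by rcases h01 b ((ρ ^ k) b') with h | h <;> simp [h]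
        _ = 41 := by simp
  -- T in terms of x
  have hTb : T b = 40 - 2 * x b := by
    simp only [hT, hx, hS_def]
    rw [Finset.sum_sub_distrib, Finset.sum_sub_distrib, Finset.sum_const, Finset.card_range, ← Finset.mul_sum,
      Finset.sum_boole, nsmul_eq_mul]
    have hfilt : (Finset.range 41).filter (fun k => b = (ρ ^ k) b) = {0} := by
      ext k
      simp only [Finset.mem_filter, Finset.mem_range, Finset.mem_singleton]
      constructor
      · rintro ⟨hkp, hfix⟩
        exact orbP_injOn ρ hp41 hρ b hρb (Finset.mem_coe.mpr (Finset.mem_range.mpr hkp))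
          (Finset.mem_coe.mpr (Finset.mem_range.mpr (by norm_num))) (by simpa using hfix.symm)
      · rintro rfl
        exact ⟨by norm_num, by simp⟩
    rw [hfilt, Finset.card_singleton]
    norm_num
  have hTb' : ∀ b' ∈ B, b' ≠ b → T b' = 41 - 2 * x b' := by
    intro b' hb' hne
    simp only [hT, hx, hS_def]
    rw [Finset.sum_sub_distrib, Finset.sum_sub_distrib, Finset.sum_const, Finset.card_range, ← Finset.mul_sum,
      nsmul_eq_mul]
    have h0 : ∑ k ∈ Finset.range 41, (if b = (ρ ^ k) b' then (1 : ℤ) else 0) = 0 := by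
      refine Finset.sum_eq_zero fun k hk => ?_
      rw [if_neg]
      intro hbk
      exact hne (honly b' hb' b (Finset.mem_image.mpr ⟨k, hk, hbk.symm⟩) hτb).symm
    rw [h0]
    norm_num
  -- `τ`-invariance: x(b') ≡ A b b' (mod 5) for b' ∈ B
  have hmod5 : ∀ b' ∈ B, ∃ q : ℤ, x b' = (if A b b' = 1 then 1 else 0) + 5 * q := by
    intro b' hb'
    have hb'ρ : ρ b' ≠ b' := (hmemB.mp hb').2
    have hP : ∀ y, (τ y ∈ orb b' ∧ A b (τ y) = 1) ↔ (y ∈ orb b' ∧ A b y = 1) := by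
      intro y
      rw [hτorb_iff b' hb' y, show A b (τ y) = A b y by rw [← hAτ b y, hτb]]
    have hmod := card_fixed_on_mod τ hp5 hτ (fun y => y ∈ orb b' ∧ A b y = 1) hP
    have e1 : (univ.filter fun y => y ∈ orb b' ∧ A b y = 1) = (orb b').filter fun y => A b y = 1 := by
      ext y; simp [Finset.mem_filter]
    have e2 : (univ.filter fun y => (y ∈ orb b' ∧ A b y = 1) ∧ τ y = y) =
        ({b'} : Finset V).filter fun y => A b y = 1 := by
      ext y
      simp only [Finset.mem_filter, Finset.mem_univ, true_and, Finset.mem_singleton]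
      constructor
      · rintro ⟨⟨hy, hAy⟩, hτy⟩; exact ⟨honly b' hb' y hy hτy, hAy⟩
      · rintro ⟨rfl, hAy⟩; exact ⟨⟨horb_self _, hAy⟩, (hmemB.mp hb').1⟩
    rw [e1, e2, Finset.filter_singleton] at hmod
    rw [hx_card b' hb'ρ]
    by_cases hA1 : A b b' = 1
    · rw [if_pos hA1, Finset.card_singleton] at hmod
      rw [if_pos hA1]
      exact ⟨((((orb b').filter fun y => A b y = 1).card : ℕ) : ℤ) / 5, by omega⟩
    · rw [if_neg hA1, Finset.card_empty] at hmod
      rw [if_neg hA1]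
      exact ⟨((((orb b').filter fun y => A b y = 1).card : ℕ) : ℤ) / 5, by omega⟩
  -- the own orbit: v = x b = 20
  have hv20 : x b = 20 := by
    obtain ⟨q, hq⟩ := hmod5 b hb
    rw [if_neg (show A b b ≠ 1 by rw [hdiag]; norm_num), zero_add] at hq
    have heven : 2 ∣ (41 : ℤ) * x b := by
      have h := aut_orbit_valency_even A hsymm hdiag hp41 ρ hρ hAρ hρb
      rw [hx_orb b hρb]
      exact_mod_cast h
    have hsq : T b * T b ≤ 87 := by
      rw [← hmain, ← Finset.add_sum_erase B _ hb]
      have : 0 ≤ ∑ b' ∈ B.erase b, T b' * T b' := Finset.sum_nonneg fun b' _ => mul_self_nonneg _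
      linarith
    rw [hTb] at hsq
    have h1 : (40 : ℤ) - 2 * x b ≤ 9 := by nlinarith
    have h2 : -9 ≤ (40 : ℤ) - 2 * x b := by nlinarith
    omega
  -- `Fix τ = Fix ρ ∪ B` is `6`-regular (srg(13,6,2,3)): c + Σ_{b' ∈ B} A b b' = 6
  set c : ℤ := ∑ y ∈ univ.filter (fun x => ρ x = x), A b y with hc
  obtain ⟨hdeg6, -⟩ := aut_order5_fixed13_srg A h01 hsymm hdiag hk hsrg τ
    (show τ ^ (5 ^ 1) = 1 by rw [pow_one]; exact hτ) hAτ hf13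
  have hdegb := hdeg6 b (Finset.mem_filter.mpr ⟨Finset.mem_univ _, hτb⟩)
  have hdeg : c + ∑ b' ∈ B.erase b, A b b' = 6 := by
    rw [← Finset.sum_filter_add_sum_filter_not (univ.filter fun y => τ y = y) (fun y => ρ y = y),
      Finset.filter_filter, Finset.filter_filter] at hdegb
    have e1 : (univ.filter fun y => τ y = y ∧ ρ y = y) = univ.filter fun y => ρ y = y := by
      ext y
      simp only [Finset.mem_filter, Finset.mem_univ, true_and]
      exact ⟨fun h => h.2, fun h => ⟨hFρτ y h, h⟩⟩
    have e2 : (univ.filter fun y => τ y = y ∧ ¬ ρ y = y) = B := rfl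
    rw [e1, e2, ← Finset.add_sum_erase B _ hb, hdiag, ← hc] at hdegb
    linarith
  -- valency of b: 166 = c + 20 + Σ_{b' ≠ b} x b'
  have hval : ∑ b' ∈ B.erase b, x b' = 146 - c := by
    have h := hk b
    rw [hsplit (A b), ← Finset.add_sum_erase B _ hb, ← hc] at h
    have e : ∑ b' ∈ B.erase b, ∑ k ∈ Finset.range 41, A b ((ρ ^ k) b') = ∑ b' ∈ B.erase b, x b' := rfl
    rw [e] at h
    have e' : ∑ k ∈ Finset.range 41, A b ((ρ ^ k) b) = x b := rfl
    rw [e', hv20] at h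
    linarith
  -- Σ_{b' ≠ b} (41 − 2 x b')² = 87
  have hsq : ∑ b' ∈ B.erase b, (41 - 2 * x b') ^ 2 = 87 := by
    rw [← hmain, ← Finset.add_sum_erase B _ hb, hTb, hv20]
    norm_num
    refine Finset.sum_congr rfl fun b' hb' => ?_
    obtain ⟨hne, hb'B⟩ := Finset.mem_erase.mp hb'
    rw [hTb' b' hb'B hne, sq]
  -- the endgame
  have hB7 : (B.erase b).card = 7 := by rw [Finset.card_erase_of_mem hb, hB8]
  choose! q hq using hmod5
  refine frob41_endgame (B.erase b) hB7 x (fun b' => if A b b' = 1 then 1 else 0) (fun b' => q b' - 4) c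
    (fun b' _ => ?_) (fun b' hb' => ?_) hsq hval ?_
  · show (if A b b' = 1 then (1 : ℤ) else 0) = 0 ∨ (if A b b' = 1 then (1 : ℤ) else 0) = 1
    by_cases h : A b b' = 1
    · exact Or.inr (if_pos h)
    · exact Or.inl (if_neg h)
  · show x b' = 20 + (if A b b' = 1 then (1 : ℤ) else 0) + 5 * (q b' - 4)
    have := hq b' (Finset.mem_erase.mp hb').2
    linarith
  · show ∑ b' ∈ B.erase b, (if A b b' = 1 then (1 : ℤ) else 0) = 6 - c
    have e : ∑ b' ∈ B.erase b, A b b' = ∑ b' ∈ B.erase b, (if A b b' = 1 then (1 : ℤ) else 0) :=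
      Finset.sum_congr rfl fun b' _ => by rcases h01 b b' with h | h <;> simp [h]
    rw [← e]
    linarith

/-- **`N(⟨ρ₄₁⟩)` is a `{2, 41}`-group** (refines gen 32's `{2, 5, 41}`). -/
theorem normalizer41_prime_dvd_card_g33 (hV : Fintype.card V = 333) (A : Matrix V V ℤ)
    (h01 : ∀ x y, A x y = 0 ∨ A x y = 1) (hsymm : ∀ x y, A y x = A x y) (hdiag : ∀ x, A x x = 0)
    (hk : ∀ x, ∑ y, A x y = 166) (hsrg : ∀ x y, ∑ z, A x z * A z y = 83 * (1 + (if x = y then 1 else 0)) - A x y)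
    (N : Subgroup (Equiv.Perm V)) (hN : ∀ g ∈ N, ∀ x y, A (g x) (g y) = A x y)
    (ρ : Equiv.Perm V) (hρ : ρ ^ 41 = 1) (hρ1 : ρ ≠ 1) (hρN : ρ ∈ N) (hnorm : ∀ g ∈ N, ∃ m : ℕ, g * ρ = ρ ^ m * g)
    {q : ℕ} (hq : q.Prime) (hqd : q ∣ Nat.card N) : q = 2 ∨ q = 41 := by
  classical
  rcases normalizer41_prime_dvd_card hV A h01 hsymm hdiag hk hsrg N hN ρ hρ hρ1 hρN hnorm hq hqd with h | h | h
  · exact Or.inl h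
  · exfalso
    subst h
    haveI := Fact.mk hq
    obtain ⟨g, hg⟩ := exists_prime_orderOf_dvd_card' 5 hqd
    have hg' : orderOf (g : Equiv.Perm V) = 5 := by rw [Subgroup.orderOf_coe, hg]
    have hg5 : (g : Equiv.Perm V) ^ 5 = 1 := by rw [← hg']; exact pow_orderOf_eq_one _
    have hg1 : (g : Equiv.Perm V) ≠ 1 := by
      intro h1; rw [h1, orderOf_one] at hg'; exact absurd hg' (by norm_num)
    obtain ⟨m, hm⟩ := hnorm g g.2
    exact no_order5_normalizing_order41 hV A h01 hsymm hdiag hk hsrg ρ g hρ hρ1 hg5 hg1 hm (hN ρ hρN) (hN g g.2)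
  · exact Or.inr h

/-- **`|N(⟨ρ₄₁⟩)| = 41 · 2^a`**: a group of automorphisms normalising `⟨ρ₄₁⟩` (with `ρ₄₁ ∈ N`) is a `{2,41}`-group with
`41`-part exactly `41`. -/
theorem normalizer41_card_shape (hV : Fintype.card V = 333) (A : Matrix V V ℤ)
    (h01 : ∀ x y, A x y = 0 ∨ A x y = 1) (hsymm : ∀ x y, A y x = A x y) (hdiag : ∀ x, A x x = 0)
    (hk : ∀ x, ∑ y, A x y = 166) (hsrg : ∀ x y, ∑ z, A x z * A z y = 83 * (1 + (if x = y then 1 else 0)) - A x y)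
    (N : Subgroup (Equiv.Perm V)) (hN : ∀ g ∈ N, ∀ x y, A (g x) (g y) = A x y)
    (ρ : Equiv.Perm V) (hρ : ρ ^ 41 = 1) (hρ1 : ρ ≠ 1) (hρN : ρ ∈ N) (hnorm : ∀ g ∈ N, ∃ m : ℕ, g * ρ = ρ ^ m * g) :
    ∃ a : ℕ, Nat.card N = 41 * 2 ^ a := by
  haveI : Fact (Nat.Prime 41) := ⟨by norm_num⟩
  have hρo : orderOf ρ = 41 := orderOf_eq_prime hρ hρ1
  have h41 : 41 ∣ Nat.card N := by
    have h := orderOf_dvd_natCard (⟨ρ, hρN⟩ : N)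
    rwa [Subgroup.orderOf_mk, hρo] at h
  obtain ⟨-, -, hsq, -⟩ := autGroup_card_not_dvd_23_37_41_83_sq hV A h01 hsymm hdiag hk hsrg N hN
  obtain ⟨n, hn⟩ := h41
  rcases Nat.eq_two_pow_or_exists_odd_prime_and_dvd n with ⟨a, rfl⟩ | ⟨q, hq, hqn, hqodd⟩
  · exact ⟨a, hn⟩
  · exfalso
    have hq2 : q ≠ 2 := by rintro rfl; exact (Nat.not_even_iff_odd.mpr hqodd) even_two
    have hqN : q ∣ Nat.card N := by rw [hn]; exact Dvd.dvd.mul_left hqn 41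
    rcases normalizer41_prime_dvd_card_g33 hV A h01 hsymm hdiag hk hsrg N hN ρ hρ hρ1 hρN hnorm hq hqN with h | h
    · exact hq2 h
    · subst h
      exact hsq (by rw [hn, pow_two]; exact Nat.mul_dvd_mul_left 41 hqn)

end noFrobenius41

end Summit.Ventures.DiscreteObjects.Hadamard
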